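import Summits.ValiantsHypothesis.ValiantsHypothesis.Theses.TwoAdicLadder
import Literature.Computability.AlgebraicComplexity.DetInVP
import Literature.Computability.AlgebraicComplexity.HighestWeightPairingCertificates

/-!
# TwoAdicLadder, support item `CeilingAllPrecisions` (stmt-ValiantsHypothesis-5951) — PROVED

Route `TwoAdicLadder` of `ValiantsHypothesis`, support item `CeilingAllPrecisions`: **for every `k`
the permanent is p-computable by division-free circuits over `ℤ/2^k`** ("the ladder is a ladder,
not a cliff"; the algebraic form of Valiant's `n^{O(k)}` algorithm for `per mod 2^k`).

Proof (symbolic, no eliminations or divisions). By Leibniz and `sign σ = (−1)^{inv σ}`,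
`per_n = Σ_σ sign σ · (1 − 2)^{inv σ} x^σ = Σ_j (−2)^j J_j` with
`J_j = Σ_σ sign σ · C(inv σ, j) · x^σ`, and modulo `2^k` only `j < k` survives. Counting the
`j`-subsets `P` of inverted column pairs, `J_j = Σ_{|P| = j} Σ_ρ det N_{P,ρ}` where `ρ` assigns to
each pair `(a < b) ∈ P` a pair of rows `(ρ₁ > ρ₂)` and `N_{P,ρ}` is the generic matrix with column
`a` *pinned* to its row-`ρ₁` entry and column `b` to its row-`ρ₂` entry for every pair of `P`
(inconsistent pinnings give a zero column): by Leibniz `det N_{P,ρ}` is the signed sum of the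
monomials `x^σ` with `σ` extending the pinning, and for each `σ` exactly one admissible `ρ` matches
iff `σ` inverts every pair of `P`. Each `det N_{P,ρ}` is a cost-free substitution instance of
`det_n`, so `L(det N_{P,ρ}) ≤ L(det_n)` (Bürgisser's substitution bound), there are at most
`n^{2j} · n^{2j}` of them for each `j < k`, and `det_n` is p-computable over every commutative ring
(Berkowitz; tree `isVPFamily_detPoly_of_commRing`): `L_{ℤ/2^k}(per_n) = n^{O(k)}`. The case `k = 1`
is `per ≡ det (mod 2)`, the case `k = 2` is item `CeilingModFour`. Honest framing: a calibration
fact inside a dormant route — the ladder's hardness, if any, must come from `k → ∞`; nothing here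
bears on VP ≠ VNP.
-/

noncomputable section

open MvPolynomial

-- the summit and the problem share the name `ValiantsHypothesis` (D-0017 single-conjunct layout)
set_option linter.dupNamespace false

namespace Summit.ValiantsHypothesis.ValiantsHypothesis.Theorems.TwoAdicLadder

open Literature.Computability.AlgebraicComplexity

variable {R : Type*} [CommRing R] {n : ℕ}

/-- Leibniz expansion of the multi-pinned generic matrix `N_{P,ρ}`: the signed sum of the monomials
`x^σ` with `σ` extending the pinning `ρ` (column `p.1 ↦` row `(ρ p).1`, column `p.2 ↦` row
`(ρ p).2` for `p ∈ P`). -/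
theorem det_multipinned_eq (P : Finset (Fin n × Fin n)) (ρ : P → Fin n × Fin n) :
    (Matrix.of fun r c : Fin n =>
        if (∀ p : P, (c = p.1.1 → r = (ρ p).1) ∧ (c = p.1.2 → r = (ρ p).2)) then
          (X (r, c) : MvPolynomial (Fin n × Fin n) R) else 0).det =
      ∑ σ : Equiv.Perm (Fin n), if (∀ p : P, σ p.1.1 = (ρ p).1 ∧ σ p.1.2 = (ρ p).2) then
        Equiv.Perm.sign σ • ∏ c, (X (σ c, c) : MvPolynomial (Fin n × Fin n) R) else 0 := by
  classical
  rw [Matrix.det_apply]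
  refine Finset.sum_congr rfl fun σ _ => ?_
  simp only [Matrix.of_apply]
  rw [Fintype.prod_ite_zero]
  have hiff : (∀ c : Fin n, ∀ p : P, (c = p.1.1 → σ c = (ρ p).1) ∧ (c = p.1.2 → σ c = (ρ p).2)) ↔
      (∀ p : P, σ p.1.1 = (ρ p).1 ∧ σ p.1.2 = (ρ p).2) := by
    constructor
    · intro h p
      exact ⟨(h _ p).1 rfl, (h _ p).2 rfl⟩
    · intro h c p
      exact ⟨fun hc => by rw [hc]; exact (h p).1, fun hc => by rw [hc]; exact (h p).2⟩
  by_cases h : ∀ p : P, σ p.1.1 = (ρ p).1 ∧ σ p.1.2 = (ρ p).2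
  · rw [if_pos (hiff.2 h), if_pos h]
  · rw [if_neg (fun h' => h (hiff.1 h')), if_neg h, smul_zero]

/-- The multi-pinned determinant is a substitution instance of `det_n` (variables ↦ variables
or `0`). -/
theorem det_multipinned_eq_aeval (P : Finset (Fin n × Fin n)) (ρ : P → Fin n × Fin n) :
    (Matrix.of fun r c : Fin n =>
        if (∀ p : P, (c = p.1.1 → r = (ρ p).1) ∧ (c = p.1.2 → r = (ρ p).2)) then
          (X (r, c) : MvPolynomial (Fin n × Fin n) R) else 0).det =
      aeval (fun v : Fin n × Fin n =>
        if (∀ p : P, (v.2 = p.1.1 → v.1 = (ρ p).1) ∧ (v.2 = p.1.2 → v.1 = (ρ p).2)) then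
          (X v : MvPolynomial (Fin n × Fin n) R) else 0) (detPoly (Fin n) R) := by
  rw [detPoly, AlgHom.map_det]
  congr 1
  ext r c
  simp only [Matrix.of_apply, AlgHom.mapMatrix_apply, Matrix.map_apply,
    Matrix.mvPolynomialX_apply, aeval_X]

/-- `L(det N_{P,ρ}) ≤ L(det_n)` (substitution of variables and zeros is free). -/
theorem complexity_det_multipinned_le (P : Finset (Fin n × Fin n)) (ρ : P → Fin n × Fin n) :
    complexity (Matrix.of fun r c : Fin n =>
        if (∀ p : P, (c = p.1.1 → r = (ρ p).1) ∧ (c = p.1.2 → r = (ρ p).2)) then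
          (X (r, c) : MvPolynomial (Fin n × Fin n) R) else 0).det ≤
      complexity (detPoly (Fin n) R) := by
  rw [det_multipinned_eq_aeval]
  refine (complexity_aeval_le _ _).trans ?_
  have h0 : ∀ v : Fin n × Fin n, complexity
      (if (∀ p : P, (v.2 = p.1.1 → v.1 = (ρ p).1) ∧ (v.2 = p.1.2 → v.1 = (ρ p).2)) then
        (X v : MvPolynomial (Fin n × Fin n) R) else 0) = 0 := by
    intro v
    split_ifs
    · exact complexity_X_holds v
    · rw [← C_0]
      exact complexity_C_holds 0
  simp only [h0, Finset.sum_const_zero, add_zero, le_refl]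

/-- For a fixed permutation `σ` exactly one admissible pinning matches, and it does iff `σ` inverts
every pair of `P`. -/
theorem sum_ite_adm_match_eq (P : Finset (Fin n × Fin n)) (σ : Equiv.Perm (Fin n)) :
    (∑ ρ : P → Fin n × Fin n,
      if (∀ p : P, (ρ p).2 < (ρ p).1) ∧ (∀ p : P, σ p.1.1 = (ρ p).1 ∧ σ p.1.2 = (ρ p).2) then
        (1 : R) else 0) =
      if ∀ p : P, σ p.1.2 < σ p.1.1 then 1 else 0 := by
  classical
  rw [Finset.sum_eq_single (fun p : P => (σ p.1.1, σ p.1.2))]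
  · simp
  · intro ρ _ hρ
    rw [if_neg]
    rintro ⟨-, hmatch⟩
    apply hρ
    funext p
    exact Prod.ext (hmatch p).1.symm (hmatch p).2.symm
  · simp

/-- Counting the `j`-sets of inverted pairs: `Σ_{P ⊆ pairs, |P| = j} [σ inverts P] = C(inv σ, j)`. -/
theorem sum_powersetCard_ite_eq_choose (j : ℕ) (σ : Equiv.Perm (Fin n)) :
    (∑ P ∈ ((Finset.univ : Finset (Fin n × Fin n)).filter (fun p => p.1 < p.2)).powersetCard j,
      if (∀ p : P, σ p.1.2 < σ p.1.1) then (1 : R) else 0) =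
      ((((Finset.univ : Finset (Fin n × Fin n)).filter
        (fun p => p.1 < p.2 ∧ σ p.2 < σ p.1)).card.choose j : ℕ) : R) := by
  classical
  rw [← Finset.natCast_card_filter, ← Finset.card_powersetCard]
  congr 2
  ext P
  simp only [Finset.mem_filter, Finset.mem_powersetCard, Finset.subset_iff, Finset.mem_univ,
    true_and, Subtype.forall]
  constructor
  · rintro ⟨⟨h1, h2⟩, h3⟩
    exact ⟨fun p hp => ⟨h1 hp, h3 p hp⟩, h2⟩
  · rintro ⟨h1, h2⟩
    exact ⟨⟨fun p hp => (h1 hp).1, h2⟩, fun p hp => (h1 hp).2⟩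

/-- The number of inverted pairs is the tree's inversion count `PairingDP.invCountP`. -/
theorem card_inv_eq_invCountP (σ : Equiv.Perm (Fin n)) :
    ((Finset.univ : Finset (Fin n × Fin n)).filter (fun p => p.1 < p.2 ∧ σ p.2 < σ p.1)).card =
      PairingDP.invCountP σ := by
  classical
  rw [Finset.card_filter, PairingDP.invCountP, Fintype.sum_prod_type]

/-- `(−1)^{inv σ} · sign σ = 1`, as an action on polynomials. -/
theorem neg_one_pow_card_inv_smul_sign_smul (σ : Equiv.Perm (Fin n))
    (x : MvPolynomial (Fin n × Fin n) R) :
    ((-1 : R) ^ ((Finset.univ : Finset (Fin n × Fin n)).filter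
        (fun p => p.1 < p.2 ∧ σ p.2 < σ p.1)).card) • (Equiv.Perm.sign σ • x) = x := by
  have h := PairingDP.sign_eq_neg_one_pow σ
  rw [← card_inv_eq_invCountP] at h
  rcases Int.units_eq_one_or (Equiv.Perm.sign σ) with hs | hs
  · rw [hs] at h ⊢
    rcases Nat.even_or_odd (((Finset.univ : Finset (Fin n × Fin n)).filter
        (fun p => p.1 < p.2 ∧ σ p.2 < σ p.1)).card) with he | ho
    · rw [he.neg_one_pow, one_smul, one_smul]
    · exfalso
      rw [ho.neg_one_pow] at h
      norm_num at h
  · rw [hs] at h ⊢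
    rcases Nat.even_or_odd (((Finset.univ : Finset (Fin n × Fin n)).filter
        (fun p => p.1 < p.2 ∧ σ p.2 < σ p.1)).card) with he | ho
    · exfalso
      rw [he.neg_one_pow] at h
      norm_num at h
    · rw [ho.neg_one_pow, Units.neg_smul, one_smul, smul_neg, neg_one_smul, neg_neg]

/-- Truncated binomial theorem: if `2^k = 0` in `R` then `(−1)^s = Σ_{j<k} (−2)^j C(s, j)`. -/
theorem neg_one_pow_eq_sum_of_two_pow_eq_zero {k : ℕ} (h2 : (2 : R) ^ k = 0) (s : ℕ) :
    ((-1 : R) ^ s) = ∑ j ∈ Finset.range k, (-2 : R) ^ j * (s.choose j : R) := by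
  have hvan : ∀ j, k ≤ j → (-2 : R) ^ j = 0 := fun j hj => by
    rw [neg_pow, pow_eq_zero_of_le hj h2, mul_zero]
  have h1 : (-1 : R) = -2 + 1 := by norm_num
  rw [h1, add_pow]
  simp only [one_pow, mul_one]
  rw [Finset.sum_subset (Finset.range_mono (Nat.le_add_right (s + 1) k)),
    Finset.sum_subset (Finset.range_mono (Nat.le_add_left k (s + 1)))]
  · intro j _ hj'
    rw [Finset.mem_range, not_lt] at hj'
    rw [hvan j hj', zero_mul]
  · intro j _ hj'
    rw [Finset.mem_range, not_lt] at hj'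
    rw [Nat.choose_eq_zero_of_lt hj', Nat.cast_zero, mul_zero]

/-- **`per_n = Σ_{j<k} (−2)^j J_j`** over any commutative ring with `2^k = 0`, where `J_j` is the sum
of the multi-pinned determinants over the `j`-sets of column pairs and their admissible pinnings. -/
theorem perPoly_eq_sum_multipinned {k : ℕ} (h2 : (2 : R) ^ k = 0) (n : ℕ) :
    perPoly (Fin n) R = ∑ j ∈ Finset.range k, ((-2 : R) ^ j) •
      ∑ P ∈ ((Finset.univ : Finset (Fin n × Fin n)).filter (fun p => p.1 < p.2)).powersetCard j,
        ∑ ρ : P → Fin n × Fin n,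
          if (∀ p : P, (ρ p).2 < (ρ p).1) then
            (Matrix.of fun r c : Fin n =>
              if (∀ p : P, (c = p.1.1 → r = (ρ p).1) ∧ (c = p.1.2 → r = (ρ p).2)) then
                (X (r, c) : MvPolynomial (Fin n × Fin n) R) else 0).det
          else 0 := by
  classical
  -- Step A: `J_j = Σ_σ C(inv σ, j) • (sign σ • x^σ)`
  have hJ : ∀ j, (∑ P ∈ ((Finset.univ : Finset (Fin n × Fin n)).filter
      (fun p => p.1 < p.2)).powersetCard j, ∑ ρ : P → Fin n × Fin n,
      if (∀ p : P, (ρ p).2 < (ρ p).1) then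
        (Matrix.of fun r c : Fin n =>
          if (∀ p : P, (c = p.1.1 → r = (ρ p).1) ∧ (c = p.1.2 → r = (ρ p).2)) then
            (X (r, c) : MvPolynomial (Fin n × Fin n) R) else 0).det
      else 0) = ∑ σ : Equiv.Perm (Fin n),
        ((((Finset.univ : Finset (Fin n × Fin n)).filter
          (fun p => p.1 < p.2 ∧ σ p.2 < σ p.1)).card.choose j : ℕ) : R) •
          (Equiv.Perm.sign σ • ∏ c, (X (σ c, c) : MvPolynomial (Fin n × Fin n) R)) := by
    intro j
    have step : ∀ (P : Finset (Fin n × Fin n)) (ρ : P → Fin n × Fin n),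
        (if (∀ p : P, (ρ p).2 < (ρ p).1) then
          (Matrix.of fun r c : Fin n =>
            if (∀ p : P, (c = p.1.1 → r = (ρ p).1) ∧ (c = p.1.2 → r = (ρ p).2)) then
              (X (r, c) : MvPolynomial (Fin n × Fin n) R) else 0).det
          else 0) = ∑ σ : Equiv.Perm (Fin n),
          (if (∀ p : P, (ρ p).2 < (ρ p).1) ∧ (∀ p : P, σ p.1.1 = (ρ p).1 ∧ σ p.1.2 = (ρ p).2)
            then (1 : R) else 0) •
            (Equiv.Perm.sign σ • ∏ c, (X (σ c, c) : MvPolynomial (Fin n × Fin n) R)) := by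
      intro P ρ
      rw [det_multipinned_eq]
      split_ifs with hadm
      · refine Finset.sum_congr rfl fun σ _ => ?_
        by_cases hm : ∀ p : P, σ p.1.1 = (ρ p).1 ∧ σ p.1.2 = (ρ p).2
        · rw [if_pos hm, if_pos ⟨hadm, hm⟩, one_smul]
        · rw [if_neg hm, if_neg (fun h => hm h.2), zero_smul]
      · symm
        refine Finset.sum_eq_zero fun σ _ => ?_
        rw [if_neg (fun h => hadm h.1), zero_smul]
    simp_rw [step]
    rw [Finset.sum_congr rfl fun P _ => Finset.sum_comm, Finset.sum_comm]
    refine Finset.sum_congr rfl fun σ _ => ?_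
    simp_rw [← Finset.sum_smul]
    congr 1
    simp_rw [sum_ite_adm_match_eq]
    exact sum_powersetCard_ite_eq_choose j σ
  -- Step B: assemble with the truncated binomial theorem and `sign σ = (−1)^{inv σ}`
  have hper : perPoly (Fin n) R =
      ∑ σ : Equiv.Perm (Fin n), ∏ c, (X (σ c, c) : MvPolynomial (Fin n × Fin n) R) := by
    rw [perPoly, Matrix.permanent]
    rfl
  rw [hper]
  simp_rw [hJ, Finset.smul_sum, smul_smul]
  rw [Finset.sum_comm]
  refine Finset.sum_congr rfl fun σ _ => ?_
  rw [← Finset.sum_smul, ← neg_one_pow_eq_sum_of_two_pow_eq_zero h2,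
    neg_one_pow_card_inv_smul_sign_smul]

/-- Size of one layer: `L(J_j) ≤ n^{2j} (n^{2j} L(det_n) + n^{2j}) + n^{2j}`. -/
theorem complexity_multipinned_layer_le (j n : ℕ) :
    complexity (∑ P ∈ ((Finset.univ : Finset (Fin n × Fin n)).filter
        (fun p => p.1 < p.2)).powersetCard j,
      ∑ ρ : P → Fin n × Fin n,
        if (∀ p : P, (ρ p).2 < (ρ p).1) then
          (Matrix.of fun r c : Fin n =>
            if (∀ p : P, (c = p.1.1 → r = (ρ p).1) ∧ (c = p.1.2 → r = (ρ p).2)) then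
              (X (r, c) : MvPolynomial (Fin n × Fin n) R) else 0).det
        else 0) ≤
      (n * n) ^ j * ((n * n) ^ j * complexity (detPoly (Fin n) R) + (n * n) ^ j) + (n * n) ^ j := by
  classical
  set U := (Finset.univ : Finset (Fin n × Fin n)).filter (fun p => p.1 < p.2) with hU
  have hUc : U.card ≤ n * n :=
    (Finset.card_filter_le _ _).trans (by simp [Finset.card_univ, Fintype.card_prod])
  have hpc : (U.powersetCard j).card ≤ (n * n) ^ j := by
    rw [Finset.card_powersetCard]
    exact (Nat.choose_le_pow _ _).trans (Nat.pow_le_pow_left hUc j)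
  have hinner : ∀ P ∈ U.powersetCard j, complexity (∑ ρ : P → Fin n × Fin n,
      if (∀ p : P, (ρ p).2 < (ρ p).1) then
        (Matrix.of fun r c : Fin n =>
          if (∀ p : P, (c = p.1.1 → r = (ρ p).1) ∧ (c = p.1.2 → r = (ρ p).2)) then
            (X (r, c) : MvPolynomial (Fin n × Fin n) R) else 0).det
      else 0) ≤ (n * n) ^ j * complexity (detPoly (Fin n) R) + (n * n) ^ j := by
    intro P hP
    have hcardP : P.card = j := (Finset.mem_powersetCard.1 hP).2
    have hcardρ : (Finset.univ : Finset (P → Fin n × Fin n)).card = (n * n) ^ j := by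
      rw [Finset.card_univ, Fintype.card_fun, Fintype.card_coe, hcardP, Fintype.card_prod,
        Fintype.card_fin]
    refine (complexity_finset_sum_le _ _).trans ?_
    rw [hcardρ]
    refine Nat.add_le_add_right ?_ _
    have hterm : ∀ ρ ∈ (Finset.univ : Finset (P → Fin n × Fin n)), complexity
        (if (∀ p : P, (ρ p).2 < (ρ p).1) then
          (Matrix.of fun r c : Fin n =>
            if (∀ p : P, (c = p.1.1 → r = (ρ p).1) ∧ (c = p.1.2 → r = (ρ p).2)) then
              (X (r, c) : MvPolynomial (Fin n × Fin n) R) else 0).det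
          else 0) ≤ complexity (detPoly (Fin n) R) := by
      intro ρ _
      split_ifs
      · exact complexity_det_multipinned_le _ _
      · rw [← C_0, complexity_C_holds]
        exact Nat.zero_le _
    refine (Finset.sum_le_card_nsmul _ _ _ hterm).trans ?_
    rw [hcardρ, smul_eq_mul]
  refine (complexity_finset_sum_le _ _).trans ?_
  refine Nat.add_le_add ?_ hpc
  refine (Finset.sum_le_card_nsmul _ _ _ hinner).trans ?_
  rw [smul_eq_mul]
  exact Nat.mul_le_mul_right _ hpc

/-- **Item `CeilingAllPrecisions` holds**: for every `k` the permanent family is p-computable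
over `ℤ/2^k`. -/
theorem ceilingAllPrecisions_proof :
    Summit.ValiantsHypothesis.ValiantsHypothesis.Theses.TwoAdicLadder.CeilingAllPrecisions := by
  unfold Summit.ValiantsHypothesis.ValiantsHypothesis.Theses.TwoAdicLadder.CeilingAllPrecisions
  intro k
  classical
  have h2 : (2 : ZMod (2 ^ k)) ^ k = 0 := by
    have h := ZMod.natCast_self (2 ^ k)
    push_cast at h
    exact h
  have hdet : IsPBounded fun n => complexity (detPoly (Fin n) (ZMod (2 ^ k))) :=
    (isVPFamily_detPoly_of_commRing (ZMod (2 ^ k))).2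
  have hpw : ∀ j, IsPBounded fun n : ℕ => (n * n) ^ j := fun j =>
    ⟨2 * j, fun n => by dsimp only; rw [← pow_two, ← pow_mul]; exact Nat.le_add_right _ _⟩
  -- one layer, plus the scalar gate
  have hlayer : ∀ j, IsPBounded fun n : ℕ =>
      (n * n) ^ j * ((n * n) ^ j * complexity (detPoly (Fin n) (ZMod (2 ^ k))) + (n * n) ^ j) +
        (n * n) ^ j + 1 := fun j =>
    IsPBounded.add_holds (IsPBounded.add_holds (IsPBounded.mul_holds (hpw j)
      (IsPBounded.add_holds (IsPBounded.mul_holds (hpw j) hdet) (hpw j))) (hpw j))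
      (IsPBounded.const 1)
  -- all layers `j < m`
  have hsum : ∀ m, IsPBounded fun n : ℕ => ∑ j ∈ Finset.range m,
      ((n * n) ^ j * ((n * n) ^ j * complexity (detPoly (Fin n) (ZMod (2 ^ k))) + (n * n) ^ j) +
        (n * n) ^ j + 1) := by
    intro m
    induction m with
    | zero =>
      simp only [Finset.range_zero, Finset.sum_empty]
      exact IsPBounded.const 0
    | succ m ih =>
      simp only [Finset.sum_range_succ]
      exact IsPBounded.add_holds ih (hlayer m)
  refine IsPBounded.mono (IsPBounded.add_holds (hsum k) (IsPBounded.const k)) fun n => ?_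
  dsimp only
  rw [perPoly_eq_sum_multipinned h2 n]
  refine (complexity_finset_sum_le _ _).trans ?_
  rw [Finset.card_range]
  refine Nat.add_le_add_right (Finset.sum_le_sum fun j _ => ?_) _
  refine (complexity_smul_le_holds _ _).trans ?_
  exact Nat.add_le_add_right (complexity_multipinned_layer_le j n) 1

end Summit.ValiantsHypothesis.ValiantsHypothesis.Theorems.TwoAdicLadder

end
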